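import Literature.AlgebraicGeometry.Motives.ComplexPointsStationarity
import Literature.AlgebraicGeometry.Motives.ClosedGraphMorphism
import Literature.AlgebraicGeometry.Motives.SegreEmbedding
import Literature.AlgebraicGeometry.Motives.VarietiesProperProofs
import HarnessLib

/-!
# Stationarity of «same image up a tower» relations on complex points ([Deligne 1971] proof of Prop. 1.15, varying source)

Topic `AlgebraicGeometry/Motives`; namespace `Literature.AlgebraicGeometry.Motives`.  Theorems only (no definition, no named
fact, no `sorry`).  Companion of ★ `ComplexPointsStationarity` (maps OUT of a fixed `X`); here the SOURCE varies along the tower.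

Let `T` be a projective `ℂ`-scheme, `π_k : S_k ⟶ T` (`S_k` projective) and `f_k : S_k ⟶ A_k` (`A_k` separated) `ℂ`-morphisms,
`k ∈ ℕ`.  On pairs of complex points of `T` consider the IMAGE relations
`R_k := {(π_k P, π_k Q) | P, Q ∈ S_k(ℂ), f_k(P) = f_k(Q)} ⊆ T(ℂ) × T(ℂ)`.

* `setOf_exists_map_eq_eq_setOf_pt_mem_image` — `R_k` is the trace on complex points of the CLOSED subset
  `(π_k × π_k)((f_k × f_k)⁻¹ Δ_{A_k}) ⊆ T ×_ℂ T` (closed: `A_k` separated, `π_k × π_k` universally closed since `S_k ×_ℂ S_k` is proper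
  and `T ×_ℂ T` separated; the trace is exact because closed points of the finite-type `ℂ`-scheme `S_k ×_ℂ S_k` are complex points
  and are dense in closed subsets — Mathlib `JacobsonSpace`, ★ `AlgPoints.exists_pt_eq_of_isClosed_singleton`, ★ `AlgPoints.eq_of_pt_eq`);
* `exists_forall_le_setOf_exists_map_eq_eq` — if `k ↦ R_k` is ANTITONE then it is EVENTUALLY CONSTANT (`T ×_ℂ T` Noetherian,
  ★ `noetherianSpace_tensor_left`);
* `exists_setOf_exists_map_eq_subset_of_iInter_subset` — hence if `⋂_k R_k ⊆ D` then already `R_{k₀} ⊆ D` for some `k₀` (with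
  `D` the diagonal: injectivity «at infinite level» up the tower forces a relation at ONE finite level).

This is the Noetherian step «la suite décroissante des `_{K(N)}R` est stationnaire» of [Deligne1971TravauxShimura] Prop. 1.15 (p. 132)
in the form needed when the finite-level varieties `S_k` CHANGE with the level and only map down to a fixed `T` (cell hodgecm-mathlib,
crux HDel, line F1ExtHodgeType v4.1, `stub_S2inj`; banked generic leaf).  HC_CM is proved only modulo the 7 printed citations until
rung 0 closes; this file proves no cell binder.

## References
* [Deligne1971TravauxShimura] P. Deligne, *Travaux de Shimura*, Sém. Bourbaki 389 (1971), Prop. 1.15 and Lemme 1.15.3, p. 132.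
* [GortzWedhorn2020] U. Görtz, T. Wedhorn, *Algebraic Geometry I* (2nd ed. 2020), §(1.9)–(1.10), Prop. 3.35 (very dense subsets /
  Jacobson), Def. 9.7 / Prop. 9.8, Cor. 13.41 (proper ⇒ closed images).
-/

noncomputable section

open CategoryTheory CategoryTheory.Limits AlgebraicGeometry MonoidalCategory Topology TopologicalSpace

namespace Literature.AlgebraicGeometry.Motives

variable {T : SchemeOver ℂ}

/-! ### One level: the image relation is the trace of a closed subset of `T ×_ℂ T` -/

section OneLevel

variable {S A : SchemeOver ℂ}

/-- `π × π : S ×_ℂ S ⟶ T ×_ℂ T` is universally closed for `S`, `T` projective over `ℂ` (cf. the general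
`Motives.universallyClosed_tensorHom_left` of `CurveLinearSystemMorphism`, not imported to keep this leaf light).
[cite: GortzWedhorn2020, Cor. 13.41] -/
theorem universallyClosed_tensorHom_left_of_isProjectiveOver (hS : IsProjectiveOver S) (hT : IsProjectiveOver T) (π : S ⟶ T) :
    UniversallyClosed (π ⊗ₘ π).left := by
  haveI : IsProper (S ⊗ S).hom := (hS.tensor hS).isProper
  haveI : IsProper (T ⊗ T).hom := (hT.tensor hT).isProper
  have h : UniversallyClosed ((π ⊗ₘ π).left ≫ (T ⊗ T).hom) := by
    rw [Over.w (π ⊗ₘ π)]; infer_instance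
  exact UniversallyClosed.of_comp_of_isSeparated (π ⊗ₘ π).left (T ⊗ T).hom

/-- On complex points of `S ×_ℂ S`: `(π × π)(R)` has components `(π (pr₁ R), π (pr₂ R))`. [folklore] -/
private theorem prodEquiv_map_tensorHom (π : S ⟶ T) (R : ComplexPoints (S ⊗ S)) :
    AlgPoints.prodEquiv (AlgPoints.map (π ⊗ₘ π) R) =
      (AlgPoints.map π (AlgPoints.map (CartesianMonoidalCategory.fst S S) R),
        AlgPoints.map π (AlgPoints.map (CartesianMonoidalCategory.snd S S) R)) := by
  refine Prod.ext ?_ ?_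
  · show (AlgPoints.prodEquiv (AlgPoints.map (π ⊗ₘ π) R)).1 =
      AlgPoints.map π (AlgPoints.map (CartesianMonoidalCategory.fst S S) R)
    rw [AlgPoints.prodEquiv_apply_fst, ← AlgPoints.map_comp_apply, ← AlgPoints.map_comp_apply,
      CartesianMonoidalCategory.tensorHom_fst]
  · show (AlgPoints.prodEquiv (AlgPoints.map (π ⊗ₘ π) R)).2 =
      AlgPoints.map π (AlgPoints.map (CartesianMonoidalCategory.snd S S) R)
    rw [AlgPoints.prodEquiv_apply_snd, ← AlgPoints.map_comp_apply, ← AlgPoints.map_comp_apply,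
      CartesianMonoidalCategory.tensorHom_snd]

/-- **The image relation `{(πP, πQ) | f P = f Q}` on `T(ℂ) × T(ℂ)` is the trace of the closed set `(π × π)((f × f)⁻¹ Δ_A)`**
(`S`, `T` projective, `A` separated over `ℂ`). [cite: Deligne1971TravauxShimura, proof of Prop. 1.15 p. 132] [cite: GortzWedhorn2020, Prop. 3.35 and Cor. 13.41] -/
theorem setOf_exists_map_eq_eq_setOf_pt_mem_image (hS : IsProjectiveOver S) (hT : IsProjectiveOver T) [IsSeparated A.hom]
    (π : S ⟶ T) (f : S ⟶ A) :
    {PQ : ComplexPoints T × ComplexPoints T | ∃ P Q : ComplexPoints S,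
        AlgPoints.map π P = PQ.1 ∧ AlgPoints.map π Q = PQ.2 ∧ AlgPoints.map f P = AlgPoints.map f Q} =
      {PQ | (AlgPoints.prodEquiv.symm PQ).pt ∈ ((π ⊗ₘ π).left : (S ⊗ S).left → (T ⊗ T).left) ''
        (((f ⊗ₘ f).left : (S ⊗ S).left → (A ⊗ A).left) ⁻¹' Set.range (pullback.diagonal A.hom))} := by
  haveI : IsProper (S ⊗ S).hom := (hS.tensor hS).isProper
  haveI : IsProper (T ⊗ T).hom := (hT.tensor hT).isProper
  haveI : LocallyOfFiniteType (S ⊗ S).hom := inferInstance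
  haveI : LocallyOfFiniteType (T ⊗ T).hom := inferInstance
  haveI : JacobsonSpace ↥(S ⊗ S).left := LocallyOfFiniteType.jacobsonSpace (S ⊗ S).hom
  ext PQ
  constructor
  · rintro ⟨P, Q, hP, hQ, hf⟩
    set R : ComplexPoints (S ⊗ S) := AlgPoints.prodEquiv.symm (P, Q) with hR
    have hRW : R ∈ {R : ComplexPoints (S ⊗ S) |
        AlgPoints.map f (AlgPoints.map (CartesianMonoidalCategory.fst S S) R) =
          AlgPoints.map f (AlgPoints.map (CartesianMonoidalCategory.snd S S) R)} := by
      show AlgPoints.map f (AlgPoints.map (CartesianMonoidalCategory.fst S S) R) =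
        AlgPoints.map f (AlgPoints.map (CartesianMonoidalCategory.snd S S) R)
      rw [hR, AlgPoints.map_fst_prodEquiv_symm, AlgPoints.map_snd_prodEquiv_symm]
      exact hf
    rw [setOf_map_fst_eq_map_snd_eq_preimage f] at hRW
    have hπR : AlgPoints.map (π ⊗ₘ π) R = AlgPoints.prodEquiv.symm PQ := by
      apply AlgPoints.prodEquiv.injective
      rw [prodEquiv_map_tensorHom, Equiv.apply_symm_apply, hR, AlgPoints.map_fst_prodEquiv_symm,
        AlgPoints.map_snd_prodEquiv_symm, hP, hQ]
    refine ⟨R.pt, hRW, ?_⟩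
    rw [← AlgPoints.pt_map, hπR]
  · rintro ⟨y, hyW, hy⟩
    -- the fibre of `π × π` over the closed point of `PQ`, inside `(f × f)⁻¹ Δ`, has a closed point
    set W := (((f ⊗ₘ f).left : (S ⊗ S).left → (A ⊗ A).left) ⁻¹' Set.range (pullback.diagonal A.hom)) with hW
    set F := W ∩ ((π ⊗ₘ π).left : (S ⊗ S).left → (T ⊗ T).left) ⁻¹' {(AlgPoints.prodEquiv.symm PQ).pt} with hF
    have hFclosed : IsClosed F :=
      (isClosed_preimage_range_diagonal f).inter
        ((AlgPoints.isClosed_singleton_pt _).preimage (π ⊗ₘ π).left.continuous)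
    have hFne : F.Nonempty := ⟨y, hyW, hy⟩
    obtain ⟨y', ⟨hy'W, hy'⟩, hy'cl⟩ := nonempty_inter_closedPoints hFne hFclosed.isLocallyClosed
    obtain ⟨R, hR⟩ := AlgPoints.exists_pt_eq_of_isClosed_singleton (X := S ⊗ S) (K := ℂ) hy'cl
    have hπR : AlgPoints.map (π ⊗ₘ π) R = AlgPoints.prodEquiv.symm PQ := by
      apply AlgPoints.eq_of_pt_eq
      rw [AlgPoints.pt_map, hR]
      exact hy'
    have hRW : R ∈ {R : ComplexPoints (S ⊗ S) |
        AlgPoints.map f (AlgPoints.map (CartesianMonoidalCategory.fst S S) R) =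
          AlgPoints.map f (AlgPoints.map (CartesianMonoidalCategory.snd S S) R)} := by
      rw [setOf_map_fst_eq_map_snd_eq_preimage f]
      show R.pt ∈ W
      rw [hR]; exact hy'W
    have hcomp := prodEquiv_map_tensorHom π R
    rw [hπR, Equiv.apply_symm_apply] at hcomp
    exact ⟨AlgPoints.map (CartesianMonoidalCategory.fst S S) R, AlgPoints.map (CartesianMonoidalCategory.snd S S) R,
      (congrArg Prod.fst hcomp).symm, (congrArg Prod.snd hcomp).symm, hRW⟩

/-- … in particular it is the trace of SOME closed subset of `T ×_ℂ T`. [cite: Deligne1971TravauxShimura, proof of Prop. 1.15 p. 132] -/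
theorem exists_isClosed_setOf_exists_map_eq_eq (hS : IsProjectiveOver S) (hT : IsProjectiveOver T) [IsSeparated A.hom]
    (π : S ⟶ T) (f : S ⟶ A) :
    ∃ Z : Set ↥(T ⊗ T).left, IsClosed Z ∧
      {PQ : ComplexPoints T × ComplexPoints T | ∃ P Q : ComplexPoints S,
          AlgPoints.map π P = PQ.1 ∧ AlgPoints.map π Q = PQ.2 ∧ AlgPoints.map f P = AlgPoints.map f Q} =
        {PQ | (AlgPoints.prodEquiv.symm PQ).pt ∈ Z} := by
  haveI := universallyClosed_tensorHom_left_of_isProjectiveOver hS hT π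
  exact ⟨_, (π ⊗ₘ π).left.isClosedMap _ (isClosed_preimage_range_diagonal f),
    setOf_exists_map_eq_eq_setOf_pt_mem_image hS hT π f⟩

end OneLevel

/-! ### The tower: antitone image relations are eventually constant -/

/-- **An antitone tower of image relations `R_k = {(π_k P, π_k Q) | f_k P = f_k Q}` on `T(ℂ) × T(ℂ)` is eventually constant**
(`T`, `S_k` projective, `A_k` separated): the `R_k` are traces of closed subsets of the Noetherian space `T ×_ℂ T`, and so are the
partial intersections. [cite: Deligne1971TravauxShimura, proof of Prop. 1.15 and Lemme 1.15.3, p. 132] [cite: GortzWedhorn2020, §(1.9)–(1.10)] -/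
theorem exists_forall_le_setOf_exists_map_eq_eq (hT : IsProjectiveOver T) {S A : ℕ → SchemeOver ℂ}
    (hS : ∀ k, IsProjectiveOver (S k)) [∀ k, IsSeparated (A k).hom] (π : ∀ k, S k ⟶ T) (f : ∀ k, S k ⟶ A k)
    (hanti : Antitone fun k => {PQ : ComplexPoints T × ComplexPoints T | ∃ P Q : ComplexPoints (S k),
        AlgPoints.map (π k) P = PQ.1 ∧ AlgPoints.map (π k) Q = PQ.2 ∧ AlgPoints.map (f k) P = AlgPoints.map (f k) Q}) :
    ∃ k₀, ∀ k, k₀ ≤ k →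
      {PQ : ComplexPoints T × ComplexPoints T | ∃ P Q : ComplexPoints (S k),
          AlgPoints.map (π k) P = PQ.1 ∧ AlgPoints.map (π k) Q = PQ.2 ∧ AlgPoints.map (f k) P = AlgPoints.map (f k) Q} =
        {PQ : ComplexPoints T × ComplexPoints T | ∃ P Q : ComplexPoints (S k₀),
          AlgPoints.map (π k₀) P = PQ.1 ∧ AlgPoints.map (π k₀) Q = PQ.2 ∧ AlgPoints.map (f k₀) P = AlgPoints.map (f k₀) Q} := by
  haveI : IsProper T.hom := hT.isProper
  haveI : LocallyOfFiniteType T.hom := inferInstance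
  haveI : QuasiCompact T.hom := inferInstance
  haveI : NoetherianSpace ↥(T ⊗ T).left := noetherianSpace_tensor_left
  -- the relations as traces of closed sets
  set Rel : ℕ → Set (ComplexPoints T × ComplexPoints T) := fun k => {PQ | ∃ P Q : ComplexPoints (S k),
      AlgPoints.map (π k) P = PQ.1 ∧ AlgPoints.map (π k) Q = PQ.2 ∧ AlgPoints.map (f k) P = AlgPoints.map (f k) Q} with hRel
  choose Z hZc hZ using fun k => exists_isClosed_setOf_exists_map_eq_eq (hS k) hT (π k) (f k)
  -- the descending partial intersections
  let Z' : ℕ → Closeds ↥(T ⊗ T).left := fun k =>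
    ⟨⋂ i, ⋂ (_ : i ≤ k), Z i, isClosed_iInter fun i => isClosed_iInter fun _ => hZc i⟩
  have hmemZ' : ∀ k (x : ↥(T ⊗ T).left), x ∈ (Z' k : Set ↥(T ⊗ T).left) ↔ ∀ i, i ≤ k → x ∈ Z i := by
    intro k x
    change x ∈ (⋂ i, ⋂ (_ : i ≤ k), Z i) ↔ _
    simp only [Set.mem_iInter]
  have hZ'anti : Antitone Z' := by
    intro m n hmn x hx
    exact (hmemZ' m x).2 fun i hi => (hmemZ' n x).1 hx i (hi.trans hmn)
  have htrace : ∀ k, Rel k = {PQ | (AlgPoints.prodEquiv.symm PQ).pt ∈ (Z' k : Set ↥(T ⊗ T).left)} := by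
    intro k
    ext PQ
    simp only [Set.mem_setOf_eq]
    rw [hmemZ']
    constructor
    · intro hPQ i hi
      have hi' : PQ ∈ Rel i := hanti hi hPQ
      rw [hRel] at hi'
      simp only at hi'
      rw [hZ i] at hi'
      exact hi'
    · intro hPQ
      have := hPQ k le_rfl
      rw [hRel]
      simp only
      rw [hZ k]
      exact this
  obtain ⟨k₀, hk₀⟩ := WellFoundedLT.antitone_chain_condition hZ'anti
  refine ⟨k₀, fun k hk => ?_⟩
  change Rel k = Rel k₀
  rw [htrace k, htrace k₀, ← hk₀ k hk]

/-- **Joint form**: if the antitone image relations satisfy `⋂_k R_k ⊆ D`, then `R_{k₀} ⊆ D` for some single `k₀` (e.g. `D` the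
diagonal of `T(ℂ)`: the `f_k` JOINTLY separate the fibres of the tower ⇒ ONE `f_{k₀}` already does, [Deligne 1971] 1.15: injective
at infinite level ⇒ injective at a finite level). [cite: Deligne1971TravauxShimura, proof of Prop. 1.15 and Lemme 1.15.3, p. 132] -/
theorem exists_setOf_exists_map_eq_subset_of_iInter_subset (hT : IsProjectiveOver T) {S A : ℕ → SchemeOver ℂ}
    (hS : ∀ k, IsProjectiveOver (S k)) [∀ k, IsSeparated (A k).hom] (π : ∀ k, S k ⟶ T) (f : ∀ k, S k ⟶ A k)
    (hanti : Antitone fun k => {PQ : ComplexPoints T × ComplexPoints T | ∃ P Q : ComplexPoints (S k),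
        AlgPoints.map (π k) P = PQ.1 ∧ AlgPoints.map (π k) Q = PQ.2 ∧ AlgPoints.map (f k) P = AlgPoints.map (f k) Q})
    {D : Set (ComplexPoints T × ComplexPoints T)}
    (hinter : (⋂ k, {PQ : ComplexPoints T × ComplexPoints T | ∃ P Q : ComplexPoints (S k),
        AlgPoints.map (π k) P = PQ.1 ∧ AlgPoints.map (π k) Q = PQ.2 ∧ AlgPoints.map (f k) P = AlgPoints.map (f k) Q}) ⊆ D) :
    ∃ k₀, {PQ : ComplexPoints T × ComplexPoints T | ∃ P Q : ComplexPoints (S k₀),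
        AlgPoints.map (π k₀) P = PQ.1 ∧ AlgPoints.map (π k₀) Q = PQ.2 ∧ AlgPoints.map (f k₀) P = AlgPoints.map (f k₀) Q} ⊆ D := by
  obtain ⟨k₀, hk₀⟩ := exists_forall_le_setOf_exists_map_eq_eq hT hS π f hanti
  refine ⟨k₀, fun PQ hPQ => hinter ?_⟩
  simp only [Set.mem_iInter]
  intro k
  by_cases hk : k₀ ≤ k
  · have h := hk₀ k hk
    exact h.symm ▸ hPQ  -- rewrite membership along the set equality
  · exact hanti (le_of_not_ge hk) hPQ

end Literature.AlgebraicGeometry.Motives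

end
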